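import Summits.BirchSwinnertonDyer.BirchSwinnertonDyer.Theorems.SchneiderFreeAdditiveX3GaloisCharacterConductor
import Literature.NumberTheory.EllipticCurves.KrizLi2019.TeichmullerCharacterExists
import Literature.NumberTheory.EllipticCurves.OpenImageMazurFrobeniusProofs
import Literature.NumberTheory.EllipticCurves.OpenImageMazurProofs
import Literature.NumberTheory.EllipticCurves.LFunctionPrimeCoeff
import Literature.NumberTheory.GaloisRepresentations.IntegralGaloisActionProofs
import Literature.NumberTheory.EllipticCurves.Rank1Residual.Predicates
import HarnessLib

/-!
# The isogeny character of a rational `p`-isogeny as a PRIMITIVE `ℚ_p`-valued Dirichlet character with the Eisenstein trace congruence —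
# Kriz–Li's character data `(f, ψ, ω)` EXIST for every `E/ℚ` with `E[p]` reducible (route `SchneiderFreeAdditiveX3`, K1 door; general lemma)

Cell `bsd-schneider-ideate`, seat `bsd-schneider-door-c5` (prover, generation 36; `--supports` 19177 as helper).  PARTITION: board row
B6 ∩ X3 ∩ sst-twist (every pair of the door has `ClassX3 W p`, i.e. `E[p]` reducible) — support for the Kriz–Li records of the door
(`KrizLiLocusLValueFree`, `KrizLiLocusSupplyThree`, `KrizLiLocusFieldThreeH3`); types-the-object-of nothing new; closes nothing; BSD NOT
advanced.  bears_on: K1-door (19177).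

WHY.  Every Kriz–Li record of the door (and `KrizLi2019.thm120_padicLogHeegner_unit_of_bernoulli` itself) binds «`E[p]` reducible with
`E[p]^{ss} ≅ 𝔽_p(ψ) ⊕ 𝔽_p(ψ⁻¹ω)`» as DATA: a primitive `ψ : DirichletCharacter ℚ_[p] f`, the Teichmüller `ω`, and the trace form
`‖a_ℓ(W) − (ψ(ℓ) + ψ⁻¹(ℓ)ω(ℓ))‖_p < 1` at the primes `ℓ ∤ pN`.  This file proves that such data EXIST for every globally minimal `W/ℚ`
with `E[p]` reducible, with `f` supported on `pN_W` — so those binders are never vacuous and the records' hypotheses are conditions on the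
VALUES of an existing character.  UNCONDITIONAL (inputs: the tree's Kronecker–Weber `KroneckerWeber_holds`, the isogeny character and
Mazur's Prop. 6.3 (1) `Mazur1978.isogenyCharacter_add_div_eq_frobeniusTrace`, Frobenius elements, the Teichmüller character
`KrizLi2019.exists_isTeichmullerCharacter`, `LFunction_apply_prime_eq_frobeniusTrace`).

WHAT.
* §1 `exists_level_of_unramified_outside` — Kronecker–Weber with the level supported on a set `S` of primes outside which the character is
  unramified (generation 34's one-prime stripping `GaloisCharacterConductor.exists_factor_level_of_unramified`, iterated; no tameness needed).
* §2 `exists_isPrimitive_zmod_of_character` — a character `r : Γ_ℚ → 𝔽_pˣ` unramified outside `S` is `σ ↦ φ(χ_f(σ))` for a PRIMITIVE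
  `φ : DirichletCharacter (ZMod p) f` with the primes of `f` in `S` (pattern of the crux sketch `Cruxes/ManinPrimeToAdditiveFiveLe/
  two_parity_member_sketch.lean` §11 `exists_isogenyCharacter_dirichlet`, adapted).
* §3 the Teichmüller lift `ψ = ω ∘ φ` on units (`MulChar.ofUnitHom (ω.toUnitHom.comp φ.toUnitHom)`, no new definition); `ω` is injective on `𝔽_pˣ`
  (`toUnitHom_injective_of_isTeichmullerCharacter`), so `ψ` is primitive when `φ` is (`isPrimitive_teichmullerLift`).
* §4 `norm_frobeniusTrace_sub_lt_one` — the Eisenstein trace congruence in `ℚ_p`: `u + ℓu⁻¹ = a_ℓ` in `𝔽_p` gives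
  `‖a_ℓ − (ω(u) + ω(u)⁻¹ω(ℓ))‖ < 1`.
* §5 **`exists_krizLiCharacterData_of_red`**: for `W/ℚ` globally minimal elliptic, `p` prime, `¬ W.HasIrreducibleModPGaloisRep p`:
  `∃ f ψ ω`, `ψ.IsPrimitive ∧ IsTeichmullerCharacter ω ∧ (∀ q prime, q ∣ f → q ∣ p·N_W) ∧` the trace form at every prime `ℓ ∤ p·N_W`.

HONEST FRAMING: unconditional tree theorems; no definition, no named fact, no `sorry`; nothing
about BSD is proved; «closes rung: none».  References: [Washington1997] Thm. 14.1, Ch. 3, §5.1; [Mazur1978] §5, Prop. 6.3; [KrizLi2019] §2, Thm. 1.20.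
-/

set_option autoImplicit false
-- `Summit.<P>.<Sub>` repeats `BirchSwinnertonDyer` by the tree's layout convention (D-0017)
set_option linter.dupNamespace false

noncomputable section

open scoped Classical NumberField

open NumberField IsDedekindDomain IsDedekindDomain.HeightOneSpectrum Field WeierstrassCurve
  Literature.NumberTheory.GaloisRepresentations Literature.NumberTheory.EllipticCurves
  Literature.NumberTheory.EllipticCurves.KrizLi2019

namespace Summit.BirchSwinnertonDyer.BirchSwinnertonDyer.Theorems.SchneiderFreeAdditiveX3.IsogenyCharacterDirichlet

/-! ### §1 Kronecker–Weber with the level supported on the ramification (no tameness) -/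

/-- **Kronecker–Weber with the level supported on `S`.**  A character `ψ : Γ_ℚ → M` (commutative) with open kernel, trivial on the inertia
groups above every rational prime outside a set `S`, factors as `β ∘ χ_m` with every prime factor of `m` in `S`: the tree's Kronecker–Weber
(`Mazur1978.exists_comp_modNCyclotomicCharacter_eq`) gives some level, and the primes outside `S` are stripped one at a time by
`GaloisCharacterConductor.exists_factor_level_of_unramified` (strong induction on the level).  UNCONDITIONAL.
[cite: Washington1997, Thm. 14.1 and Ch. 3 (pp. 19–21)] -/
theorem exists_level_of_unramified_outside {M : Type*} [CommGroup M] (ψ : absoluteGaloisGroup ℚ →* M)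
    (hker : IsOpen ((ψ.ker : Subgroup (absoluteGaloisGroup ℚ)) : Set (absoluteGaloisGroup ℚ))) (S : Set ℕ)
    (hunr : ∀ p : ℕ, p.Prime → p ∉ S → ∀ (v : HeightOneSpectrum (𝓞 ℚ)), Rat.HeightOneSpectrum.natGenerator v = p →
      ∀ 𝔓 ∈ v.primesAbove, ∀ τ ∈ 𝔓.inertia (absoluteGaloisGroup ℚ), ψ τ = 1) :
    ∃ (m : ℕ) (_ : NeZero m) (β : (ZMod m)ˣ →* M), (∀ p : ℕ, p.Prime → p ∣ m → p ∈ S) ∧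
      ∀ σ : absoluteGaloisGroup ℚ, β (modNCyclotomicCharacter ℚ m σ) = ψ σ := by
  obtain ⟨m₀, hm₀, β₀, hβ₀⟩ := Mazur1978.exists_comp_modNCyclotomicCharacter_eq ψ hker
  suffices key : ∀ (m : ℕ) (_ : NeZero m) (β : (ZMod m)ˣ →* M),
      (∀ σ : absoluteGaloisGroup ℚ, β (modNCyclotomicCharacter ℚ m σ) = ψ σ) →
      ∃ (m' : ℕ) (_ : NeZero m') (β' : (ZMod m')ˣ →* M), (∀ p : ℕ, p.Prime → p ∣ m' → p ∈ S) ∧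
        ∀ σ : absoluteGaloisGroup ℚ, β' (modNCyclotomicCharacter ℚ m' σ) = ψ σ from key m₀ hm₀ β₀ hβ₀
  intro m
  induction m using Nat.strong_induction_on with
  | _ m ih =>
    intro hm β hβ
    by_cases h1 : ∃ p : ℕ, p.Prime ∧ p ∣ m ∧ p ∉ S
    · obtain ⟨p, hp, hpm, hpS⟩ := h1
      haveI : Fact p.Prime := ⟨hp⟩
      obtain ⟨e, d, hd, hme⟩ := Nat.exists_eq_pow_mul_and_not_dvd (NeZero.ne m) p hp.one_lt.ne'
      obtain ⟨k, rfl⟩ : ∃ k, e = k + 1 := by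
        rcases Nat.eq_zero_or_pos e with h0 | h0
        · exfalso
          rw [hme, h0, pow_zero, one_mul] at hpm
          exact hd hpm
        · exact ⟨e - 1, by omega⟩
      obtain ⟨hd0, β', hβ'⟩ :=
        GaloisCharacterConductor.exists_factor_level_of_unramified ψ β hβ hme hd (hunr p hp hpS)
      have hlt : d < m := by
        have hd1 : 0 < d := Nat.pos_of_ne_zero (NeZero.ne d)
        have hp2 : 2 ≤ p ^ (k + 1) := le_trans hp.two_le (Nat.le_self_pow (Nat.succ_ne_zero k) p)
        rw [hme]
        nlinarith
      exact ih d hlt hd0 β' hβ'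
    · push Not at h1
      exact ⟨m, hm, β, fun p hp hpm => h1 p hp hpm, hβ⟩

/-! ### §2 A character `Γ_ℚ → 𝔽_pˣ` unramified outside `S` as a PRIMITIVE Dirichlet character of level supported on `S` -/

/-- **A character `r : Γ_ℚ → 𝔽_pˣ` with open kernel, unramified outside `S`, is `σ ↦ φ(χ_f(σ))` for a PRIMITIVE Dirichlet character
`φ : (ℤ/f)ˣ → 𝔽_pˣ` whose level `f` has all its prime factors in `S`** (§1, then pass to the primitive character inducing `MulChar.ofUnitHom β`;
its conductor divides the level; compatibility `χ_m mod f = χ_f`).  UNCONDITIONAL. [cite: Washington1997, Thm. 14.1 and Ch. 3]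
[cite: Mazur1978, §5 (p. 148)] -/
theorem exists_isPrimitive_zmod_of_character (p : ℕ) [Fact p.Prime] (r : absoluteGaloisGroup ℚ →* (ZMod p)ˣ)
    (hker : IsOpen ((r.ker : Subgroup (absoluteGaloisGroup ℚ)) : Set (absoluteGaloisGroup ℚ))) (S : Set ℕ)
    (hunr : ∀ q : ℕ, q.Prime → q ∉ S → ∀ (v : HeightOneSpectrum (𝓞 ℚ)), Rat.HeightOneSpectrum.natGenerator v = q →
      ∀ 𝔓 ∈ v.primesAbove, ∀ τ ∈ 𝔓.inertia (absoluteGaloisGroup ℚ), r τ = 1) :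
    ∃ (f : ℕ) (_ : NeZero f) (φ : DirichletCharacter (ZMod p) f), φ.IsPrimitive ∧ (∀ q : ℕ, q.Prime → q ∣ f → q ∈ S) ∧
      ∀ σ : absoluteGaloisGroup ℚ,
        φ ((modNCyclotomicCharacter ℚ f σ : (ZMod f)ˣ) : ZMod f) = ((r σ : (ZMod p)ˣ) : ZMod p) := by
  obtain ⟨m, hm, β, hmS, hβ⟩ := exists_level_of_unramified_outside r hker S hunr
  set χ : DirichletCharacter (ZMod p) m := MulChar.ofUnitHom β with hχdef
  haveI : NeZero χ.conductor := ⟨χ.conductor_ne_zero⟩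
  refine ⟨χ.conductor, inferInstance, χ.primitiveCharacter, χ.primitiveCharacter_isPrimitive,
    fun q hq hqf => hmS q hq (hqf.trans χ.conductor_dvd_level), fun σ => ?_⟩
  have h := χ.primitiveCharacter.changeLevel_toUnitHom χ.conductor_dvd_level
  rw [DirichletCharacter.changeLevel_primitiveCharacter] at h
  calc χ.primitiveCharacter ((modNCyclotomicCharacter ℚ χ.conductor σ : (ZMod χ.conductor)ˣ) : ZMod χ.conductor)
      = ((χ.primitiveCharacter.toUnitHom (modNCyclotomicCharacter ℚ χ.conductor σ) : (ZMod p)ˣ) : ZMod p) :=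
        (MulChar.coe_toUnitHom _ _).symm
    _ = ((χ.primitiveCharacter.toUnitHom (ZMod.unitsMap χ.conductor_dvd_level (modNCyclotomicCharacter ℚ m σ)) :
          (ZMod p)ˣ) : ZMod p) := by
        rw [Mazur1978.unitsMap_modNCyclotomicCharacter χ.conductor_dvd_level σ]
    _ = ((χ.toUnitHom (modNCyclotomicCharacter ℚ m σ) : (ZMod p)ˣ) : ZMod p) := by rw [h]; rfl
    _ = χ ((modNCyclotomicCharacter ℚ m σ : (ZMod m)ˣ) : ZMod m) := MulChar.coe_toUnitHom _ _
    _ = ((β (modNCyclotomicCharacter ℚ m σ) : (ZMod p)ˣ) : ZMod p) := MulChar.ofUnitHom_coe _ _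
    _ = ((r σ : (ZMod p)ˣ) : ZMod p) := by rw [hβ]


/-! ### §3 The Teichmüller lift `ψ = ω ∘ φ` of an `𝔽_p`-valued Dirichlet character, and its primitivity -/

section Teichmuller

variable {p : ℕ} [Fact p.Prime]

/-- Least residues of units of `ℤ/p` are prime to `p`. [folklore] -/
theorem not_dvd_val_of_unit (u : (ZMod p)ˣ) : ¬ (p : ℤ) ∣ (((u : ZMod p).val : ℕ) : ℤ) := by
  have hpp : p.Prime := Fact.out
  intro h
  have hc := ZMod.val_coe_unit_coprime u
  have hdvd : p ∣ (u : ZMod p).val := by exact_mod_cast h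
  have : p ∣ Nat.gcd (u : ZMod p).val p := Nat.dvd_gcd hdvd (dvd_refl p)
  rw [hc] at this
  exact hpp.one_lt.ne' (Nat.dvd_one.mp this)

/-- The least-residue lift of a unit, read back in `ℤ/p`. [folklore] -/
theorem intCast_val_unit (u : (ZMod p)ˣ) : ((((u : ZMod p).val : ℕ) : ℤ) : ZMod p) = (u : ZMod p) := by
  rw [Int.cast_natCast, ZMod.natCast_zmod_val]

/-- **A Teichmüller character is injective on `𝔽_pˣ`**: `ω(x) = ω(y)` forces the least residues of `x` and `y` to be congruent modulo `p`
(`‖ω(a) − a‖ < 1` for both, ultrametric inequality, `‖n‖_p < 1 ⟺ p ∣ n`). [cite: Washington1997, §5.1 (the Teichmüller character)] -/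
theorem toUnitHom_injective_of_isTeichmullerCharacter {ω : DirichletCharacter ℚ_[p] p} (hω : IsTeichmullerCharacter ω) :
    Function.Injective ω.toUnitHom := by
  intro x y hxy
  set a : ℤ := (((x : ZMod p).val : ℕ) : ℤ) with ha_def
  set b : ℤ := (((y : ZMod p).val : ℕ) : ℤ) with hb_def
  have ha := hω a (not_dvd_val_of_unit x)
  have hb := hω b (not_dvd_val_of_unit y)
  rw [ha_def, intCast_val_unit] at ha
  rw [hb_def, intCast_val_unit] at hb
  have hxy' : ω (x : ZMod p) = ω (y : ZMod p) := by
    have h := congrArg Units.val hxy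
    rwa [MulChar.coe_toUnitHom, MulChar.coe_toUnitHom] at h
  have hab : ‖((a - b : ℤ) : ℚ_[p])‖ < 1 := by
    have hsplit : ((a - b : ℤ) : ℚ_[p]) = ((a : ℚ_[p]) - ω (x : ZMod p)) + (ω (y : ZMod p) - (b : ℚ_[p])) := by
      rw [hxy']; push_cast; ring
    rw [hsplit]
    refine lt_of_le_of_lt (Padic.nonarchimedean _ _) (max_lt ?_ ?_)
    · rw [norm_sub_rev]; exact_mod_cast ha
    · exact_mod_cast hb
  have hdvd : (p : ℤ) ∣ a - b := Padic.norm_intCast_lt_one_iff.mp hab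
  have hval : (x : ZMod p) = (y : ZMod p) := by
    rw [← intCast_val_unit x, ← intCast_val_unit y]
    exact (ZMod.intCast_eq_intCast_iff_dvd_sub a b p).mpr (by rw [← neg_sub]; exact hdvd.neg_right)
  exact Units.ext hval

variable {f : ℕ}

/- The Teichmüller lift of an `𝔽_p`-valued Dirichlet character `φ` mod `f` along `ω` is the `ℚ_p`-valued character
`MulChar.ofUnitHom (ω.toUnitHom.comp φ.toUnitHom)` (`ψ(x) = ω(φ(x))` on units, `0` off units); it is written out in full below (no new
definition). -/

/-- Value of the lift at a unit. [folklore] -/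
theorem teichmullerLift_coe_unit (ω : DirichletCharacter ℚ_[p] p) (φ : DirichletCharacter (ZMod p) f) (x : (ZMod f)ˣ) :
    (MulChar.ofUnitHom (ω.toUnitHom.comp φ.toUnitHom) : DirichletCharacter ℚ_[p] f) (x : ZMod f) = ω (φ (x : ZMod f)) := by
  rw [MulChar.ofUnitHom_coe, MonoidHom.comp_apply, MulChar.coe_toUnitHom, MulChar.coe_toUnitHom]

/-- The unit homomorphism of the lift is `ω ∘ φ`. [folklore] -/
theorem toUnitHom_teichmullerLift (ω : DirichletCharacter ℚ_[p] p) (φ : DirichletCharacter (ZMod p) f) :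
    MulChar.toUnitHom (MulChar.ofUnitHom (ω.toUnitHom.comp φ.toUnitHom) : DirichletCharacter ℚ_[p] f) = ω.toUnitHom.comp φ.toUnitHom := by
  refine MonoidHom.ext fun x => Units.ext ?_
  rw [MulChar.coe_toUnitHom, teichmullerLift_coe_unit, MonoidHom.comp_apply, MulChar.coe_toUnitHom, MulChar.coe_toUnitHom]

/-- The lift factors through a level `d` iff `φ` does (`ω` is injective on units). [cite: Washington1997, Ch. 3 (pp. 19–21)] -/
theorem factorsThrough_teichmullerLift_iff [NeZero f] {ω : DirichletCharacter ℚ_[p] p} (hω : IsTeichmullerCharacter ω)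
    (φ : DirichletCharacter (ZMod p) f) (d : ℕ) :
    DirichletCharacter.FactorsThrough (MulChar.ofUnitHom (ω.toUnitHom.comp φ.toUnitHom) : DirichletCharacter ℚ_[p] f) d ↔ φ.FactorsThrough d := by
  by_cases hd : d ∣ f
  · rw [DirichletCharacter.factorsThrough_iff_ker_unitsMap hd, DirichletCharacter.factorsThrough_iff_ker_unitsMap hd,
      toUnitHom_teichmullerLift]
    constructor
    · intro h a ha
      have h1 := h ha
      rw [MonoidHom.mem_ker] at h1 ⊢
      rw [MonoidHom.comp_apply] at h1
      exact toUnitHom_injective_of_isTeichmullerCharacter hω (by rw [h1, map_one])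
    · intro h a ha
      have h1 := h ha
      rw [MonoidHom.mem_ker] at h1 ⊢
      rw [MonoidHom.comp_apply, h1, map_one]
  · exact ⟨fun h => absurd h.dvd hd, fun h => absurd h.dvd hd⟩

/-- The lift has the same conductor as `φ`. [cite: Washington1997, Ch. 3 (pp. 19–21)] -/
theorem conductor_teichmullerLift [NeZero f] {ω : DirichletCharacter ℚ_[p] p} (hω : IsTeichmullerCharacter ω)
    (φ : DirichletCharacter (ZMod p) f) :
    DirichletCharacter.conductor (MulChar.ofUnitHom (ω.toUnitHom.comp φ.toUnitHom) : DirichletCharacter ℚ_[p] f) = φ.conductor := by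
  unfold DirichletCharacter.conductor DirichletCharacter.conductorSet
  congr 1
  ext d
  exact factorsThrough_teichmullerLift_iff hω φ d

/-- **The Teichmüller lift of a primitive character is primitive.** [cite: Washington1997, Ch. 3 (pp. 19–21)] -/
theorem isPrimitive_teichmullerLift [NeZero f] {ω : DirichletCharacter ℚ_[p] p} (hω : IsTeichmullerCharacter ω)
    {φ : DirichletCharacter (ZMod p) f} (hφ : φ.IsPrimitive) :
    DirichletCharacter.IsPrimitive (MulChar.ofUnitHom (ω.toUnitHom.comp φ.toUnitHom) : DirichletCharacter ℚ_[p] f) := by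
  unfold DirichletCharacter.IsPrimitive at hφ ⊢
  rw [conductor_teichmullerLift hω, hφ]
/-! ### §4 The Eisenstein trace congruence in `ℚ_p` -/

/-- `ω(u)⁻¹ = ω(u⁻¹)` on units. [folklore] -/
theorem inv_apply_unit (ω : DirichletCharacter ℚ_[p] p) (u : (ZMod p)ˣ) :
    (ω (u : ZMod p))⁻¹ = ω ((u⁻¹ : (ZMod p)ˣ) : ZMod p) := by
  refine inv_eq_of_mul_eq_one_right ?_
  rw [← map_mul, Units.mul_inv, map_one]

/-- **The trace congruence lifted to `ℚ_p`.**  If `u + ℓ·u⁻¹ = t` in `𝔽_p` (`u ∈ 𝔽_pˣ`, `p ∤ ℓ`), then for a Teichmüller character `ω`: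
`‖t − (ω(u) + ω(u)⁻¹·ω(ℓ))‖_p < 1` — the least residues `U, V` of `u, u⁻¹` satisfy `p ∣ U + ℓV − t`, and `ω(U) ≡ U`, `ω(V) ≡ V`,
`ω(ℓ) ≡ ℓ` modulo `pℤ_p`. [cite: KrizLi2019, Thm. 1.20 transcription (trace form)] [cite: Washington1997, §5.1] -/
theorem norm_sub_lt_one_of_trace_congr {ω : DirichletCharacter ℚ_[p] p} (hω : IsTeichmullerCharacter ω) (u : (ZMod p)ˣ)
    {ℓ : ℕ} (hℓ : ¬ p ∣ ℓ) (t : ℤ)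
    (h : (u : ZMod p) + (ℓ : ZMod p) * ((u⁻¹ : (ZMod p)ˣ) : ZMod p) = (t : ZMod p)) :
    ‖(t : ℚ_[p]) - (ω (u : ZMod p) + (ω (u : ZMod p))⁻¹ * ω (ℓ : ZMod p))‖ < 1 := by
  set U : ℤ := (((u : ZMod p).val : ℕ) : ℤ) with hU
  set V : ℤ := ((((u⁻¹ : (ZMod p)ˣ) : ZMod p).val : ℕ) : ℤ) with hV
  -- the three Teichmüller congruences
  have hXu := hω U (not_dvd_val_of_unit u)
  have hYv := hω V (not_dvd_val_of_unit u⁻¹)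
  rw [hU, intCast_val_unit] at hXu
  rw [hV, intCast_val_unit] at hYv
  have hℓ' : ¬ (p : ℤ) ∣ (ℓ : ℤ) := by exact_mod_cast hℓ
  have hZ := hω (ℓ : ℤ) hℓ'
  rw [Int.cast_natCast] at hZ
  -- the integer congruence `p ∣ U + ℓ V − t`
  have hcong : (((U + ℓ * V - t : ℤ)) : ZMod p) = 0 := by
    push_cast
    rw [hU, hV, intCast_val_unit, intCast_val_unit, ← h]
    ring
  have hD : ‖((U + ℓ * V - t : ℤ) : ℚ_[p])‖ < 1 :=
    Padic.norm_intCast_lt_one_iff.mpr ((ZMod.intCast_zmod_eq_zero_iff_dvd _ p).mp hcong)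
  -- algebra: `t − (ω u + (ω u)⁻¹ ω ℓ) = −D + (U − ωU) + V·(ℓ − ωℓ) + (V − ωV)·ℓ − (V − ωV)(ℓ − ωℓ)`
  rw [inv_apply_unit]
  have key : (t : ℚ_[p]) - (ω (u : ZMod p) + ω ((u⁻¹ : (ZMod p)ˣ) : ZMod p) * ω (ℓ : ZMod p)) =
      -(((U + ℓ * V - t : ℤ)) : ℚ_[p]) + ((U : ℚ_[p]) - ω (u : ZMod p)) + (V : ℚ_[p]) * ((ℓ : ℚ_[p]) - ω (ℓ : ZMod p)) +
        ((V : ℚ_[p]) - ω ((u⁻¹ : (ZMod p)ˣ) : ZMod p)) * (ℓ : ℚ_[p]) -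
        ((V : ℚ_[p]) - ω ((u⁻¹ : (ZMod p)ˣ) : ZMod p)) * ((ℓ : ℚ_[p]) - ω (ℓ : ZMod p)) := by
    push_cast; ring
  rw [key]
  have hXu' : ‖(U : ℚ_[p]) - ω (u : ZMod p)‖ < 1 := by rw [norm_sub_rev]; exact_mod_cast hXu
  have hYv' : ‖(V : ℚ_[p]) - ω ((u⁻¹ : (ZMod p)ˣ) : ZMod p)‖ < 1 := by rw [norm_sub_rev]; exact_mod_cast hYv
  have hZ' : ‖(ℓ : ℚ_[p]) - ω (ℓ : ZMod p)‖ < 1 := by rw [norm_sub_rev]; exact_mod_cast hZ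
  have hVle : ‖(V : ℚ_[p])‖ ≤ 1 := by exact_mod_cast Padic.norm_int_le_one V
  have hℓle : ‖(ℓ : ℚ_[p])‖ ≤ 1 := by exact_mod_cast Padic.norm_int_le_one (ℓ : ℤ)
  have h1 : ‖-(((U + ℓ * V - t : ℤ)) : ℚ_[p])‖ < 1 := by rw [norm_neg]; exact hD
  have h3 : ‖(V : ℚ_[p]) * ((ℓ : ℚ_[p]) - ω (ℓ : ZMod p))‖ < 1 := by
    rw [norm_mul]; exact mul_lt_one_of_nonneg_of_lt_one_right hVle (norm_nonneg _) hZ'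
  have h4 : ‖((V : ℚ_[p]) - ω ((u⁻¹ : (ZMod p)ˣ) : ZMod p)) * (ℓ : ℚ_[p])‖ < 1 := by
    rw [norm_mul]; exact mul_lt_one_of_nonneg_of_lt_one_left (norm_nonneg _) hYv' hℓle
  have h5 : ‖((V : ℚ_[p]) - ω ((u⁻¹ : (ZMod p)ˣ) : ZMod p)) * ((ℓ : ℚ_[p]) - ω (ℓ : ZMod p))‖ < 1 := by
    rw [norm_mul]; exact mul_lt_one_of_nonneg_of_lt_one_left (norm_nonneg _) hYv' hZ'.le
  have nonarch : ∀ x y : ℚ_[p], ‖x‖ < 1 → ‖y‖ < 1 → ‖x + y‖ < 1 := fun x y hx hy =>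
    lt_of_le_of_lt (Padic.nonarchimedean x y) (max_lt hx hy)
  have nonarch' : ∀ x y : ℚ_[p], ‖x‖ < 1 → ‖y‖ < 1 → ‖x - y‖ < 1 := fun x y hx hy => by
    rw [sub_eq_add_neg]; exact nonarch x (-y) hx (by rw [norm_neg]; exact hy)
  exact nonarch' _ _ (nonarch _ _ (nonarch _ _ (nonarch _ _ h1 hXu') h3) h4) h5

end Teichmuller

/-! ### §5 Kriz–Li's character data exist for every curve with `E[p]` reducible -/

/-- **The isogeny character of a rational `p`-isogeny as Kriz–Li character data.**  For `W/ℚ` globally minimal elliptic and a prime `p`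
with `E[p]` reducible (`¬ W.HasIrreducibleModPGaloisRep p`, i.e. a `Γ_ℚ`-stable line `⟨T⟩ ≤ E[p]` with isogeny character
`r : Γ_ℚ → 𝔽_pˣ`, `σT = r(σ)T`): there are a level `f ≥ 1` all of whose prime factors divide `p·N_W`, a PRIMITIVE Dirichlet character
`ψ : (ℤ/f)ˣ → ℚ_pˣ` and a Teichmüller character `ω` mod `p` such that for every prime `ℓ ∤ p·N_W`
`‖a_ℓ(W) − (ψ(ℓ) + ψ⁻¹(ℓ)·ω(ℓ))‖_p < 1` — «`E[p]^{ss} ≅ 𝔽_p(ψ) ⊕ 𝔽_p(ψ⁻¹ω)`» in the trace form of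
`KrizLi2019.thm120_padicLogHeegner_unit_of_bernoulli`.  PROOF: `r` has open kernel and is unramified at the good primes `ℓ ≠ p`
(`Mazur1978.isogenyCharacter_eq_one_of_mem_inertia`); §2 writes `r = φ ∘ χ_f` with `φ` primitive mod `f`, `f` supported on the bad primes
and `p`; `ψ := ω ∘ φ` (§3) is primitive; at a good `ℓ ≠ p` an arithmetic Frobenius `φ_ℓ` has `χ_f(φ_ℓ) = ℓ` and
`r(φ_ℓ) + ℓ·r(φ_ℓ)⁻¹ = a_ℓ` in `𝔽_p` (Mazur's Prop. 6.3 (1), `Mazur1978.isogenyCharacter_add_div_eq_frobeniusTrace`; `a_ℓ = W.LFunction ℓ` by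
`LFunction_apply_prime_eq_frobeniusTrace`), and §4 lifts the congruence to `ℚ_p`.  UNCONDITIONAL.
[cite: Mazur1978, §5 (p. 148) and Prop. 6.3 (1) (p. 153)] [cite: Washington1997, Thm. 14.1, Ch. 3, §5.1]
[cite: KrizLi2019, §2 (p. 12) and Thm. 1.20 (pp. 7–8)] -/
theorem exists_krizLiCharacterData_of_red (W : WeierstrassCurve ℚ) [W.IsElliptic] [W.IsGloballyMinimal] (p : ℕ) [hp : Fact p.Prime]
    (hred : ¬ W.HasIrreducibleModPGaloisRep p) :
    ∃ (f : ℕ) (_ : NeZero f) (ψ : DirichletCharacter ℚ_[p] f) (ω : DirichletCharacter ℚ_[p] p),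
      ψ.IsPrimitive ∧ IsTeichmullerCharacter ω ∧ (∀ q : ℕ, q.Prime → q ∣ f → q ∣ p * W.conductorNorm ℤ) ∧
      ∀ ℓ : ℕ, ℓ.Prime → ¬ (ℓ ∣ p * W.conductorNorm ℤ) →
        ‖((W.LFunction ℓ : ℤ) : ℚ_[p]) - (ψ (ℓ : ZMod f) + ψ⁻¹ (ℓ : ZMod f) * ω (ℓ : ZMod p))‖ < 1 := by
  have hpP : p.Prime := hp.out
  -- a stable line `⟨T⟩` and its isogeny character `r`
  obtain ⟨H, hH, hcard⟩ := (Mazur1978.not_hasIrreducibleModPGaloisRep_iff_exists_natCard_eq W p).mp hred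
  obtain ⟨T, hT0, rfl⟩ := Mazur1978.exists_eq_zmultiples_of_natCard_eq W p hcard
  have hst : ∀ σ : absoluteGaloisGroup ℚ, σ • T ∈ AddSubgroup.zmultiples T :=
    fun σ => hH σ T (AddSubgroup.mem_zmultiples T)
  obtain ⟨r, hr⟩ := Mazur1978.exists_isogenyCharacter W p hT0 hst
  have hker := Mazur1978.isOpen_ker_of_smul_eq W p hT0 hr
  -- good reduction off `p·N_W`
  have hgood : ∀ (q : ℕ) [Fact q.Prime], ¬ q ∣ p * W.conductorNorm ℤ → W.HasGoodReductionAtPrime q := by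
    intro q _ hqnd
    by_contra hng
    exact hqnd (dvd_mul_of_dvd_right ((W.dvd_conductorNorm_iff_not_hasGoodReductionAtPrime q).mpr hng) p)
  -- `r` is unramified outside `S` = the bad primes and `p`
  set S : Set ℕ := {q | q.Prime ∧ q ∣ p * W.conductorNorm ℤ} with hSdef
  have hunr : ∀ q : ℕ, q.Prime → q ∉ S → ∀ (v : HeightOneSpectrum (𝓞 ℚ)), Rat.HeightOneSpectrum.natGenerator v = q →
      ∀ 𝔓 ∈ v.primesAbove, ∀ τ ∈ 𝔓.inertia (absoluteGaloisGroup ℚ), r τ = 1 := by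
    intro q hq hqS v hgen 𝔓 h𝔓 τ hτ
    have hqnd : ¬ q ∣ p * W.conductorNorm ℤ := fun h => hqS ⟨hq, h⟩
    have hgoodv : W.HasGoodReductionAt v := by
      haveI hF := Fact.mk (Rat.HeightOneSpectrum.primesEquiv v).2
      refine (hasGoodReductionAtPrime_iff_hasGoodReductionAt_ringOfIntegers v W).mp (hgood _ ?_)
      have hq' : ((Rat.HeightOneSpectrum.primesEquiv v : Nat.Primes) : ℕ) = q := hgen
      rw [hq']
      exact hqnd
    have hpv : ((p : ℕ) : 𝓞 ℚ) ∉ v.asIdeal := by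
      intro hmem
      have h1 : ((Rat.HeightOneSpectrum.primesEquiv v : Nat.Primes) : ℕ) = p := primesEquiv_eq_of_natCast_mem hpP hmem
      have h2 : ((Rat.HeightOneSpectrum.primesEquiv v : Nat.Primes) : ℕ) = q := hgen
      exact hqnd (by rw [← h2, h1]; exact dvd_mul_right p _)
    exact Mazur1978.isogenyCharacter_eq_one_of_mem_inertia W p hT0 hr hgoodv hpv h𝔓 hτ
  -- §2: `r = φ ∘ χ_f`, `φ` primitive, `f` supported on `S`
  obtain ⟨f, hf, φ, hφprim, hfS, hφ⟩ := exists_isPrimitive_zmod_of_character p r hker S hunr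
  -- §3: the Teichmüller lift
  obtain ⟨ω, hω⟩ := KrizLi2019.exists_isTeichmullerCharacter (p := p)
  refine ⟨f, hf, MulChar.ofUnitHom (ω.toUnitHom.comp φ.toUnitHom), ω, isPrimitive_teichmullerLift hω hφprim, hω,
    fun q hq hqf => (hfS q hq hqf).2, ?_⟩
  -- §4: the trace form at a prime `ℓ ∤ p·N_W`
  intro ℓ hℓ hℓpN
  haveI := Fact.mk hℓ
  have hℓp : ℓ ≠ p := fun h => hℓpN (by rw [h]; exact dvd_mul_right p _)
  have hpℓ : ¬ p ∣ ℓ := fun h => hℓp ((Nat.prime_dvd_prime_iff_eq hpP hℓ).mp h).symm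
  have hgoodℓ : W.HasGoodReductionAtPrime ℓ := hgood ℓ hℓpN
  have hℓf : ¬ ℓ ∣ f := fun h => hℓpN (hfS ℓ hℓ h).2
  -- the place of `ℚ` at `ℓ`, a prime of `\bar ℤ` above it, an arithmetic Frobenius
  set v : HeightOneSpectrum (𝓞 ℚ) := Rat.HeightOneSpectrum.primesEquiv.symm ⟨ℓ, hℓ⟩ with hvdef
  have hgen : Rat.HeightOneSpectrum.natGenerator v = ℓ := by
    change ((Rat.HeightOneSpectrum.primesEquiv v : Nat.Primes) : ℕ) = ℓ
    rw [hvdef, Equiv.apply_symm_apply]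
  have hvℓ : ((ℓ : ℕ) : 𝓞 ℚ) ∈ v.asIdeal := by
    have h := Mazur1978.natCast_natGenerator_mem_asIdeal v
    rwa [hgen] at h
  obtain ⟨𝔓, h𝔓⟩ := HeightOneSpectrum.primesAbove_nonempty v
  obtain ⟨φF, hφF⟩ := exists_isArithFrobAt_of_mem_primesAbove_holds (K := ℚ) (v := v) h𝔓
  -- Mazur's Prop. 6.3 (1): `r(φ) + ℓ·r(φ)⁻¹ = a_ℓ` in `𝔽_p`
  have htrace := Mazur1978.isogenyCharacter_add_div_eq_frobeniusTrace W p ℓ hℓp hgoodℓ hT0 hr hvℓ h𝔓 hφF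
  -- `χ_f(φ) = ℓ`, so `φ(ℓ) = r(φ)`
  have hχ : ((modNCyclotomicCharacter ℚ f φF : (ZMod f)ˣ) : ZMod f) = (ℓ : ℕ) :=
    Literature.NumberTheory.GaloisRepresentations.Rat.modNCyclotomicCharacter_of_isArithFrobAt hℓ hℓf hvℓ h𝔓 hφF
  have hcop : Nat.Coprime ℓ f := (Nat.Prime.coprime_iff_not_dvd hℓ).mpr hℓf
  set xu : (ZMod f)ˣ := ZMod.unitOfCoprime ℓ hcop with hxudef
  have hxu : (xu : ZMod f) = (ℓ : ZMod f) := ZMod.coe_unitOfCoprime ℓ hcop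
  set u : (ZMod p)ˣ := r φF with hudef
  have hφℓ : φ (ℓ : ZMod f) = (u : ZMod p) := by rw [← hχ, hφ φF]
  have hψℓ : (MulChar.ofUnitHom (ω.toUnitHom.comp φ.toUnitHom) : DirichletCharacter ℚ_[p] f) (ℓ : ZMod f) = ω (u : ZMod p) := by
    rw [← hxu, teichmullerLift_coe_unit, hxu, hφℓ]
  have hψℓ' : (MulChar.ofUnitHom (ω.toUnitHom.comp φ.toUnitHom) : DirichletCharacter ℚ_[p] f)⁻¹ (ℓ : ZMod f) =
      (ω (u : ZMod p))⁻¹ := by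
    rw [MulChar.inv_apply_eq_inv', hψℓ]
  rw [hψℓ, hψℓ', LFunction_apply_prime_eq_frobeniusTrace W ℓ hgoodℓ]
  exact norm_sub_lt_one_of_trace_congr hω u hpℓ (W.frobeniusTrace ℓ) htrace


/-- **On the K1 door the Kriz–Li character data exist at every pair** (`ClassX3 W p` contains `Red W p` = `E[p]` reducible): the binders
`(f, ψ, ω)` with primitivity, the Teichmüller property, `f` supported on `p·N_W` and the trace form, as consumed by this seat's
`KrizLiLocusLValueFree` / `KrizLiLocusSupplyThree` / `KrizLiLocusFieldThreeH3` and by `KrizLi2019.thm120_padicLogHeegner_unit_of_bernoulli`.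
UNCONDITIONAL. [cite: Mazur1978, §5 (p. 148) and Prop. 6.3 (1)] [cite: KrizLi2019, §2 (p. 12) and Thm. 1.20] -/
theorem exists_krizLiCharacterData_of_classX3 (W : WeierstrassCurve ℚ) [W.IsElliptic] [W.IsGloballyMinimal] (p : ℕ) [Fact p.Prime]
    (hX : Rank1Residual.ClassX3 W p) :
    ∃ (f : ℕ) (_ : NeZero f) (ψ : DirichletCharacter ℚ_[p] f) (ω : DirichletCharacter ℚ_[p] p),
      ψ.IsPrimitive ∧ IsTeichmullerCharacter ω ∧ (∀ q : ℕ, q.Prime → q ∣ f → q ∣ p * W.conductorNorm ℤ) ∧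
      ∀ ℓ : ℕ, ℓ.Prime → ¬ (ℓ ∣ p * W.conductorNorm ℤ) →
        ‖((W.LFunction ℓ : ℤ) : ℚ_[p]) - (ψ (ℓ : ZMod f) + ψ⁻¹ (ℓ : ZMod f) * ω (ℓ : ZMod p))‖ < 1 :=
  exists_krizLiCharacterData_of_red W p hX.1

end Summit.BirchSwinnertonDyer.BirchSwinnertonDyer.Theorems.SchneiderFreeAdditiveX3.IsogenyCharacterDirichlet

end
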